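import Mathlib.GroupTheory.GroupAction.Quotient
import Mathlib.Analysis.Normed.Group.InfiniteSum
import Mathlib.Topology.Algebra.InfiniteSum.Constructions
import Mathlib.Topology.Algebra.InfiniteSum.NatInt
import Mathlib.Analysis.Normed.Module.Basic
import HarnessLib

/-!
# Sums over a `G`-set regrouped by orbits and by cosets of stabilisers

[[cite: Shintani1975, §2, (2.8)–(2.9) (p. 102)]] — the unfolding of Shintani's theta lift starts
from `θ(w, z) = ∑_{x ∈ L} …`, regrouped as `∑_{x ∈ L/Γ} ∑_{γ ∈ Γ_x∖Γ} …` ("the summation is taken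
over all `Γ`-equivalence classes", (2.14)).  This file PROVES the underlying rearrangement for a
summable `g : X → E` on a `G`-set (`E` complete), Mathlib-only:

* `tsum_eq_tsum_orbits` — `∑_x g(x) = ∑_{ω ∈ X/G} ∑_{x ∈ ω} g(x)` (`HasSum.tsum_fiberwise` for the
  orbit map; the fibres are the orbits);
* `tsum_orbit_eq_tsum_quotient_stabilizer` — `∑_{x ∈ G x₀} g(x) = ∑_{q ∈ G/G_{x₀}} g(q.out • x₀)`
  (Mathlib's `orbitEquivQuotientStabilizer`);
* `tsum_eq_tsum_orbits_quotient` — the two combined.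

No named facts, no definitions.
-/

noncomputable section

open MulAction

namespace Literature.NumberTheory.EllipticCurves.ModularForms

variable {G X E : Type*} [Group G] [MulAction G X] [NormedAddCommGroup E]

/-- The fibre of the orbit map over `ω` is the orbit `ω`. [folklore] -/
theorem preimage_orbitRel_mk_eq_orbit (ω : orbitRel.Quotient G X) :
    (Quotient.mk'' : X → orbitRel.Quotient G X) ⁻¹' {ω} = ω.orbit := by
  ext x
  rw [Set.mem_preimage, Set.mem_singleton_iff, orbitRel.Quotient.mem_orbit]

/-- **Regrouping by orbits**: for a summable `g : X → E` on a `G`-set `X` (`E` complete),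
`∑_x g(x) = ∑_{ω ∈ X/G} ∑_{x ∈ ω} g(x)`. [folklore] -/
theorem tsum_eq_tsum_orbits [CompleteSpace E] {g : X → E} (hg : Summable g) :
    ∑' x, g x = ∑' ω : orbitRel.Quotient G X, ∑' x : ω.orbit, g x := by
  have h := (hg.hasSum.tsum_fiberwise (Quotient.mk'' : X → orbitRel.Quotient G X)).tsum_eq
  rw [← h]
  refine tsum_congr fun ω ↦ ?_
  exact ((Equiv.setCongr (preimage_orbitRel_mk_eq_orbit ω)).symm.tsum_eq
    (fun x : ((Quotient.mk'' : X → orbitRel.Quotient G X) ⁻¹' {ω}) ↦ g x)).symm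

/-- Absolute summability descends to each orbit. [folklore] -/
theorem summable_norm_orbit {g : X → E} (hg : Summable fun x ↦ ‖g x‖) (ω : orbitRel.Quotient G X) :
    Summable fun x : ω.orbit ↦ ‖g x‖ :=
  hg.comp_injective Subtype.val_injective

/-- **An orbit sum as a sum over cosets of the stabiliser**: for `x₀ ∈ X`,
`∑_{x ∈ G x₀} g(x) = ∑_{q ∈ G/G_{x₀}} g(q.out • x₀)`. [folklore] -/
theorem tsum_orbit_eq_tsum_quotient_stabilizer (g : X → E) (x₀ : X) :
    ∑' x : orbit G x₀, g x = ∑' q : G ⧸ stabilizer G x₀, g (q.out • x₀) := by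
  rw [← (MulAction.orbitEquivQuotientStabilizer G x₀).symm.tsum_eq]
  refine tsum_congr fun q ↦ ?_
  congr 1
  conv_lhs => rw [← QuotientGroup.out_eq' q]
  exact MulAction.orbitEquivQuotientStabilizer_symm_apply G x₀ q.out

/-- The orbit of a representative: `∑_{x ∈ (⟦x₀⟧ : X/G).orbit} g = ∑_{x ∈ G x₀} g`. [folklore] -/
theorem tsum_orbitRel_mk_eq (g : X → E) (x₀ : X) :
    ∑' x : (orbitRel.Quotient.orbit (Quotient.mk'' x₀ : orbitRel.Quotient G X)), g x =
      ∑' x : orbit G x₀, g x :=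
  (Equiv.setCongr (MulAction.orbitRel.Quotient.orbit_mk (G := G) x₀)).symm.tsum_eq
    (fun x : orbit G x₀ ↦ g x) |>.symm |>.symm

/-- **Orbit–stabiliser regrouping**: `∑_x g(x) = ∑_{ω} ∑_{q ∈ G/G_{ω.out}} g(q.out • ω.out)`. [folklore] -/
theorem tsum_eq_tsum_orbits_quotient [CompleteSpace E] {g : X → E} (hg : Summable g) :
    ∑' x, g x = ∑' ω : orbitRel.Quotient G X,
      ∑' q : G ⧸ stabilizer G ω.out, g (q.out • ω.out) := by
  rw [tsum_eq_tsum_orbits (G := G) hg]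
  refine tsum_congr fun ω ↦ ?_
  have hω := Quotient.out_eq' ω
  set x₁ := ω.out
  clear_value x₁
  subst hω
  rw [tsum_orbitRel_mk_eq, tsum_orbit_eq_tsum_quotient_stabilizer]

end Literature.NumberTheory.EllipticCurves.ModularForms
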